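import Summits.QuantumFields.GaugeBoot.FreeEnergyPlaquetteBounds
import HarnessLib

/-!
# Gauge-boot: sharp weak-coupling asymptotics of the mean action from the free energy density
# (supplement 21, part 1b — asymptotic extraction)

HONEST FRAMING (cell `pub-gaugeboot`, page 1 of every file): certified bounds on lattice
expectations at STATED coupling, gauge group, dimension and torus size; NOT a mass gap, NOT a
continuum limit, NOT a string tension, NOT large `N`; NOT Yang–Mills-summit-bearing (barriers
`FixedCouplingUltralocality`, `PerturbativeInvisibility`).  An ASYMPTOTIC statement (`β → ∞`, threshold
not computed) about thermodynamic-limit quantities; it certifies no number of the cell's tables.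

## Content

* `WeakCouplingSharp.exists_chords` — if `f β + a log β → K` as `β → ∞` (`a ≥ 0`), then for every
  `ε > 0` and all large `β` there are `β' < β < β''` with
  `(f β' − f β)/(β − β') ≤ (a + ε)/β` and `(a − ε)/β ≤ (f β − f β'')/(β'' − β)` (`β' = (1−η)β`,
  `β'' = (1+η)β`, `η ~ ε/a`);
* ★★★ `WeakCouplingSharp.eventually_abs_sub_le` — with `f` the torus free energy density of a continuous
  representation `ρ` of a compact second-countable group: for every `ε > 0` there is `β₀` such that for
  all `β ≥ β₀`, for all large `L`, `|β · |Λ_{L+1}|⁻¹⟨S⟩_{β,L+1} − a| ≤ ε` (Griffiths' lemma of part 1);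
* ★★★ `WeakCouplingSharp.abs_sub_le_of_mem_limitPoints` — and at every infinite-volume limit point `μ` at
  such `β`, for every plaquette of `ℤ^d`: `|β · #{i<j} · (N − ∫ Re tr ρ(U_P) dμ) − a| ≤ ε` — the
  plaquette deficit `1 − ⟨(1/N) Re tr U_P⟩` is `(a/(#{i<j} N)) β⁻¹ (1 + o(1))`, BOTH SIDES.

Part 2 (`UNPlaquetteWeakCouplingSharp`) feeds Chatterjee's theorem: `a = (d−1)N²/2` for `U(N)`, whence
`1 − ⟨(1/N) Re tr U_P⟩ ~ N/(dβ)`.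

[folklore] (R. B. Griffiths, J. Math. Phys. 5 (1964) 1215; S. Friedli, Y. Velenik, *Statistical Mechanics
of Lattice Systems* (2017) Thm. 3.6, App. B.2.)
-/

noncomputable section

open MeasureTheory Filter Topology
open Literature.MathematicalPhysics.QuantumFieldTheory
open Literature.MathematicalPhysics.QuantumLattice (LGConfig plaquetteObs infiniteVolumeLimitPoints freeEnergyDensity)

namespace Summit.QuantumFields.GaugeBoot

variable {d N : ℕ} {G : Type*} [Group G] [TopologicalSpace G] [IsTopologicalGroup G]
  [CompactSpace G] [MeasurableSpace G] [BorelSpace G] (ρ : G →* Matrix (Fin N) (Fin N) ℂ)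

namespace WeakCouplingSharp

/-- **The two chords of an asymptotically logarithmic function.**  If `f β + a log β → K` as
`β → ∞` with `a ≥ 0`, then for every `ε > 0` there is `β₀ > 0` such that every `β ≥ β₀` admits
`β' < β < β''` with `(f β' − f β)/(β − β') ≤ (a + ε)/β` and `(a − ε)/β ≤ (f β − f β'')/(β'' − β)`
(take `β' = (1−η)β`, `β'' = (1+η)β` with `η ~ ε/a`). [folklore] -/
theorem exists_chords {f : ℝ → ℝ} {a K : ℝ} (ha : 0 ≤ a)
    (hK : Tendsto (fun β : ℝ => f β + a * Real.log β) atTop (𝓝 K)) {ε : ℝ} (hε : 0 < ε) :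
    ∃ β₀ : ℝ, 0 < β₀ ∧ ∀ β : ℝ, β₀ ≤ β →
      (∃ β' : ℝ, β' < β ∧ (f β' - f β) / (β - β') ≤ (a + ε) / β) ∧
      (∃ β'' : ℝ, β < β'' ∧ (a - ε) / β ≤ (f β - f β'') / (β'' - β)) := by
  -- the step `η` and the tolerance `δ`
  set η : ℝ := min (1 / 2) (ε / (8 * (a + 1))) with hη
  have hη0 : 0 < η := lt_min (by norm_num) (by positivity)
  have hη2 : η ≤ 1 / 2 := min_le_left _ _
  have hηa : a * η ≤ ε / 8 := by
    have h1 : η ≤ ε / (8 * (a + 1)) := min_le_right _ _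
    calc a * η ≤ a * (ε / (8 * (a + 1))) := mul_le_mul_of_nonneg_left h1 ha
      _ ≤ ε / 8 := by
          rw [← mul_div_assoc, div_le_div_iff₀ (by positivity) (by norm_num)]
          nlinarith
  set δ : ℝ := η * ε / 4 with hδ
  have hδ0 : 0 < δ := by positivity
  obtain ⟨β₁, hβ₁⟩ := (Metric.tendsto_atTop.1 hK) δ hδ0
  refine ⟨max (2 * β₁) 2, lt_max_of_lt_right (by norm_num), fun β hβ => ?_⟩
  have hβ2 : 2 ≤ β := (le_max_right _ _).trans hβ
  have hβ0 : 0 < β := by linarith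
  have hββ₁ : β₁ ≤ β := by
    rcases le_or_gt β₁ 0 with h | h
    · linarith
    · linarith [(le_max_left _ _).trans hβ]
  have hg : ∀ γ : ℝ, β₁ ≤ γ → |f γ + a * Real.log γ - K| < δ := fun γ hγ => by
    have := hβ₁ γ hγ; rwa [Real.dist_eq] at this
  refine ⟨⟨(1 - η) * β, by nlinarith, ?_⟩, ⟨(1 + η) * β, by nlinarith, ?_⟩⟩
  · -- upper chord with `β' = (1 − η) β`
    have hβ' : β₁ ≤ (1 - η) * β := by
      rcases le_or_gt β₁ 0 with h | h
      · have : 0 ≤ (1 - η) * β := by nlinarith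
        linarith
      · nlinarith [(le_max_left _ _).trans hβ]
    have hβ'0 : 0 < (1 - η) * β := by nlinarith
    have h1 := hg _ hβ'
    have h2 := hg _ hββ₁
    have hlog : Real.log β - Real.log ((1 - η) * β) ≤ η + 2 * η ^ 2 := by
      rw [← Real.log_div hβ0.ne' hβ'0.ne', show β / ((1 - η) * β) = (1 - η)⁻¹ by field_simp]
      have h1η : 0 < 1 - η := by linarith
      calc Real.log (1 - η)⁻¹ ≤ (1 - η)⁻¹ - 1 := Real.log_le_sub_one_of_pos (by positivity)
        _ = η / (1 - η) := by field_simp; ring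
        _ ≤ η + 2 * η ^ 2 := by
            rw [div_le_iff₀ h1η]; nlinarith
    have hdiff : f ((1 - η) * β) - f β ≤ 2 * δ + a * (η + 2 * η ^ 2) := by
      have e1 := (abs_lt.1 h1)
      have e2 := (abs_lt.1 h2)
      nlinarith [mul_le_mul_of_nonneg_left hlog ha]
    rw [show β - (1 - η) * β = η * β by ring, div_le_div_iff₀ (by positivity) hβ0]
    calc (f ((1 - η) * β) - f β) * β ≤ (2 * δ + a * (η + 2 * η ^ 2)) * β :=
          mul_le_mul_of_nonneg_right hdiff hβ0.le
      _ = (ε / 2 + a + 2 * (a * η)) * (η * β) := by rw [hδ]; ring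
      _ ≤ (a + ε) * (η * β) := by
          refine mul_le_mul_of_nonneg_right ?_ (by positivity)
          linarith
  · -- lower chord with `β'' = (1 + η) β`
    have hβ'' : β₁ ≤ (1 + η) * β := by nlinarith
    have hβ''0 : 0 < (1 + η) * β := by positivity
    have h1 := hg _ hβ''
    have h2 := hg _ hββ₁
    have hlog : η - η ^ 2 ≤ Real.log ((1 + η) * β) - Real.log β := by
      rw [← Real.log_div hβ''0.ne' hβ0.ne', show (1 + η) * β / β = 1 + η by field_simp]
      calc η - η ^ 2 ≤ 1 - (1 + η)⁻¹ := by
            rw [show 1 - (1 + η)⁻¹ = η / (1 + η) by field_simp; ring, le_div_iff₀ (by positivity)]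
            nlinarith
        _ ≤ Real.log (1 + η) := Real.one_sub_inv_le_log_of_pos (by positivity)
    have hdiff : a * (η - η ^ 2) - 2 * δ ≤ f β - f ((1 + η) * β) := by
      have e1 := (abs_lt.1 h1)
      have e2 := (abs_lt.1 h2)
      nlinarith [mul_le_mul_of_nonneg_left hlog ha]
    rw [show (1 + η) * β - β = η * β by ring, div_le_div_iff₀ hβ0 (by positivity)]
    calc (a - ε) * (η * β) ≤ (a - a * η - ε / 2) * (η * β) := by
          refine mul_le_mul_of_nonneg_right ?_ (by positivity)
          linarith
      _ = (a * (η - η ^ 2) - 2 * δ) * β := by rw [hδ]; ring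
      _ ≤ (f β - f ((1 + η) * β)) * β := mul_le_mul_of_nonneg_right hdiff hβ0.le

variable [SecondCountableTopology G]

/-- ★★★ **Sharp weak-coupling asymptotics of the mean action, uniformly in large volumes.**  If the
torus free energy density satisfies `f(β) + a log β → K` (`a ≥ 0`), then for every `ε > 0` there is
`β₀ > 0` such that for every `β ≥ β₀`, for all sufficiently large `L`:
`|β · |Λ_{L+1}|⁻¹⟨S⟩_{β,L+1} − a| ≤ ε`. [folklore] -/
theorem eventually_abs_sub_le (hρ : Continuous ρ) {a K : ℝ} (ha : 0 ≤ a)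
    (hK : Tendsto (fun β : ℝ => freeEnergyDensity d ρ β + a * Real.log β) atTop (𝓝 K))
    {ε : ℝ} (hε : 0 < ε) :
    ∃ β₀ : ℝ, 0 < β₀ ∧ ∀ β : ℝ, β₀ ≤ β →
      ∀ᶠ L : ℕ in atTop, |β * actionDensity ρ d β (L + 1) - a| ≤ ε := by
  obtain ⟨β₀, hβ₀, H⟩ := exists_chords ha hK (half_pos hε)
  refine ⟨β₀, hβ₀, fun β hβ => ?_⟩
  have hβ0 : 0 < β := hβ₀.trans_le hβ
  obtain ⟨⟨β', hβ', hup⟩, ⟨β'', hβ'', hlow⟩⟩ := H β hβ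
  have hε' : 0 < ε / 2 / β := by positivity
  filter_upwards [eventually_actionDensity_le_chord (d := d) ρ hρ hβ' hε',
    eventually_chord_le_actionDensity (d := d) ρ hρ hβ'' hε'] with L h1 h2
  rw [abs_le]
  constructor
  · have h3 : (a - ε / 2) / β - ε / 2 / β ≤ actionDensity ρ d β (L + 1) := by linarith
    rw [← sub_div, div_le_iff₀ hβ0] at h3
    linarith
  · have h3 : actionDensity ρ d β (L + 1) ≤ (a + ε / 2) / β + ε / 2 / β := by linarith
    rw [← add_div, le_div_iff₀ hβ0] at h3
    linarith

/-- ★★★ **Sharp weak-coupling asymptotics at every infinite-volume limit point.**  Under the same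
hypothesis, for every `ε > 0` there is `β₀ > 0` such that for every `β ≥ β₀`, every infinite-volume
limit point `μ` of the torus Wilson states at `β` and every plaquette `(x; i ≠ j)` of `ℤ^d`:
`|β · #{i<j} · (N − ∫ Re tr ρ(U_P) dμ) − a| ≤ ε`. [folklore] -/
theorem abs_sub_le_of_mem_limitPoints (hρ : Continuous ρ) (hN : N ≠ 0) {a K : ℝ} (ha : 0 ≤ a)
    (hK : Tendsto (fun β : ℝ => freeEnergyDensity d ρ β + a * Real.log β) atTop (𝓝 K))
    {ε : ℝ} (hε : 0 < ε) :
    ∃ β₀ : ℝ, 0 < β₀ ∧ ∀ β : ℝ, β₀ ≤ β → ∀ μ ∈ infiniteVolumeLimitPoints (d := d) ρ β,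
      ∀ (x : Literature.Probability.LatticeModels.Site d) (i j : Fin d), i ≠ j →
        |β * ((Fintype.card {p : Fin d × Fin d // p.1 < p.2} : ℝ) *
          ((N : ℝ) - ∫ U, plaquetteObs ρ x i j U ∂μ)) - a| ≤ ε := by
  obtain ⟨β₀, hβ₀, H⟩ := exists_chords ha hK hε
  refine ⟨β₀, hβ₀, fun β hβ μ hμ x i j hij => ?_⟩
  have hβ0 : 0 < β := hβ₀.trans_le hβ
  obtain ⟨⟨β', hβ', hup⟩, ⟨β'', hβ'', hlow⟩⟩ := H β hβ
  have h1 := le_chord_of_mem_limitPoints (d := d) ρ hρ hN hβ' hμ x hij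
  have h2 := chord_le_of_mem_limitPoints (d := d) ρ hρ hN hβ'' hμ x hij
  set v := (Fintype.card {p : Fin d × Fin d // p.1 < p.2} : ℝ) * ((N : ℝ) - ∫ U, plaquetteObs ρ x i j U ∂μ)
  rw [abs_le]
  constructor
  · have h3 : (a - ε) / β ≤ v := hlow.trans h2
    rw [div_le_iff₀ hβ0] at h3
    linarith
  · have h3 : v ≤ (a + ε) / β := h1.trans hup
    rw [le_div_iff₀ hβ0] at h3
    linarith

end WeakCouplingSharp

end Summit.QuantumFields.GaugeBoot

end
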